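import Summits.CriticalPhenomena.SAWScalingLimit.Theses.SAWConePseudogroup

/-!
# `SAWConePseudogroup.Assembly` (stmt-CriticalPhenomena-7308): the assembly of the route

Closes the assembly item of route `SAWConePseudogroup` of the sub-problem `SAWScalingLimit`:

  `Assembly := LSWSimpleRestriction → LimitExists → RestrictionOfLimit → SimpleOfLimit →
    LatticeSimilarityOfLimit → ContinuityOfLimit → EndpointApproxExists → PowerMapUniversality →
    PseudogroupDensity → CovarianceUpgrade → SAWScalingLimit`.

Proof (`sawConePseudogroup_assembly_proof`), pure logic plus one standard conversion, exactly the
route's deciding theorem `closes`: take the full scaling limit `P` from `LimitExists`;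
`LatticeSimilarityOfLimit` (fed `EndpointApproxExists`) and `ContinuityOfLimit` supply the two
remaining hypotheses of `CovarianceUpgrade`, which with `PowerMapUniversality` and
`PseudogroupDensity` gives `P.IsConformallyCovariant`; `RestrictionOfLimit` is
`P.IsRestriction` verbatim and `SimpleOfLimit` the simple/boundary-avoiding clause, so
`LSWSimpleRestriction` identifies every `P D` as the chordal SLE(8/3) law, `P D = map Γ ℙ` with
`IsSLECurve (8/3) D Γ`; `integral_map` converts `TendstoLaw … id (P D)` into
`TendstoLaw … Γ preWienerMeasure`, and eventual a.e.-measurability of `γ ↦ γ.curve` is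
`SAW.aemeasurable_curve` — this is `ConvergesInLawToSLE (8/3) D`, i.e. `SAWScalingLimit`.
No named fact is used; axioms are the standard three.

References: G. Lawler, O. Schramm, W. Werner, *Conformal restriction: the chordal case* (2003),
Thm. 6.1 / Cor. 8.6; G. Lawler, O. Schramm, W. Werner, *On the scaling limit of planar
self-avoiding walk* (2004), §3.4 and Prediction 1 (§4.1).
-/

noncomputable section

open MeasureTheory Filter Topology Set
open Literature.Probability.RandomPlanarGeometry
open Summit.CriticalPhenomena.SAWScalingLimit.Theses.SAWConePseudogroup
open scoped ENNReal NNReal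

namespace Summit.CriticalPhenomena.SAWScalingLimit.Theorems

/-- **Assembly of route SAWConePseudogroup** (item stmt-CriticalPhenomena-7308):
`LSWSimpleRestriction → LimitExists → RestrictionOfLimit → SimpleOfLimit →
LatticeSimilarityOfLimit → ContinuityOfLimit → EndpointApproxExists → PowerMapUniversality →
PseudogroupDensity → CovarianceUpgrade → SAWScalingLimit`. The full limit `P` of `LimitExists` is
conformally covariant by `CovarianceUpgrade` (fed the lattice similarities, the sequential
continuity, power-map universality and pseudogroup density), has restriction and simple
boundary-avoiding curves, hence is chordal SLE(8/3) in every domain by `LSWSimpleRestriction`;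
the limit statement of `LimitExists` transported along `P D = map Γ ℙ` (`integral_map`) is then
convergence in law of the critical `δℤ²` SAW to chordal SLE(8/3), i.e. `SAWScalingLimit`.
[cite: LawlerSchrammWerner2003Restriction, Thm. 6.1 and Cor. 8.6]
[cite: LawlerSchrammWerner2004SAW, §3.4 and Prediction 1 (§4.1)] -/
theorem sawConePseudogroup_assembly_proof :
    Summit.CriticalPhenomena.SAWScalingLimit.Theses.SAWConePseudogroup.Assembly := by
  unfold Summit.CriticalPhenomena.SAWScalingLimit.Theses.SAWConePseudogroup.Assembly
  intro hLSW hLim hRestr hSimple hSim hCont hEnd hPow hDens hUp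
  -- the full scaling limit `P` of the critical δℤ² SAW laws (not yet identified)
  obtain ⟨P, hch, hlim⟩ := hLim
  -- lattice similarities + power-map universality + pseudogroup density ⇒ conformal covariance
  have hcov : P.IsConformallyCovariant :=
    hUp hEnd hPow hDens P hch hlim (hSim hEnd P hch hlim) (hCont P hch hlim)
  -- two-sided restriction (product form is `ChordalFamily.IsRestriction` verbatim)
  have hres : P.IsRestriction := hRestr P hch hlim
  -- LSW03: chordal + conformally covariant + restriction + simple boundary-avoiding ⇒ SLE(8/3)
  have hSLE : ∀ D : DobrushinDomain, IsSLELaw ((8 : ℝ≥0) / 3) D (P D) :=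
    hLSW P hch hcov hres (hSimple P hch hlim)
  -- conversion `IsSLELaw` + (lim) ⇒ `ConvergesInLawToSLE`, i.e. the sub-problem statement
  intro D a b hab
  obtain ⟨Γ, hΓ, hPD⟩ := hSLE D
  refine ⟨Γ, hΓ, Filter.Eventually.of_forall fun δ => SAW.aemeasurable_curve _ _ _ _, ?_⟩
  intro f
  have key : ∫ γ, f (id γ) ∂(P D) =
      ∫ ω, f (Γ ω) ∂Literature.Probability.Process.preWienerMeasure := by
    rw [hPD]
    exact MeasureTheory.integral_map hΓ.aemeasurable f.continuous.aestronglyMeasurable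
  have h := hlim D a b hab f
  rw [key] at h
  exact h

end Summit.CriticalPhenomena.SAWScalingLimit.Theorems

end
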